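import Literature.NumberTheory.ComplexMultiplication.CMStructureIsogenousPrimitivePower
import Literature.AlgebraicGeometry.ComplexMultiplication.CMAlgebraDegreeLeEightFamiliesHodge
import Literature.AlgebraicGeometry.ComplexMultiplication.CMAbelianVarietyHomPrimitiveTypes
import Literature.AlgebraicGeometry.ComplexMultiplication.SimpleCMAbelianVarietyIsogenyClassesGaloisOrbits
import HarnessLib

/-!
# An abelian variety of CM type over `ℂ`, defined over a number field, becomes isogenous over a finite normal
# extension to a biproduct of PRIMITIVE CM structures of pairwise inequivalent types
# (Shimura 1998, §5.1 Prop. 3, §6.2 Thm. 3, §8.2 Prop. 26, §12.4 Prop. 26; Milne 1999 §2; [Fal83] §5 ¶1)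

Topic `Literature/NumberTheory/ComplexMultiplication`, namespace `Literature.NumberTheory.ComplexMultiplication`.
THEOREMS ONLY (no definition, no named fact, no instance; net Literature debt 0).  Cell `hodgecm-mathlib`
(D-0151), T5 distance ledger, item (N9a): the reduction feeding the tree's family theorem
`faltings_tate_bijective_of_isIsogenous_biproduct_of_inducedCMType_ne` ((N6c)) over a common normal extension,
for EVERY abelian variety over a number field whose complexification is of CM type (`Milne1999.IsOfCMType`, the
hypothesis of the summit's `CMAbelianHodge` read over number fields).

THE STATEMENT (`exists_isIsogenous_biproduct_primitive_family_of_isOfCMType`).  Let `A` be an abelian variety over a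
number field `k ⊂ ℂ` with `A ⊗ ℂ` of CM type.  Then there are a finite NORMAL `E/k` inside `ℂ`, a finite family
`(K_c, Φ_c, B_c, ι_c)_{c ∈ C}` of structures of PRIMITIVE CM types over `E` whose types are pairwise
`Aut`-inequivalent (`inducedCMType θ Φ_c ≠ Φ_{c'}` for every field isomorphism `θ`), and an index map
`cls : Fin m → C` with `A ⊗_k E ∼ ⨁_i B_{cls i}` (both directions).

THE PROOF (every sentence a ★ theorem of the tree; this file assembles).
1. Over `ℂ` ([Shi98] §5.1 Prop. 3 + Poincaré; Deligne 1982 I 5.1): `exists_isIsogeny_biproduct_of_isSimple_of_isOfCMType`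
   — `A ⊗ ℂ ⟶ ⨁_i A'_{cls i}` onto a biproduct of SIMPLE, pairwise non-isogenous realisations `(A'_c, ι'_c, θ'_c)`
   of CM types `(K'_c; Φ'_c)`; simplicity gives primitivity (`isPrimitive_of_isSimple`, [Shi98] §8.2 Prop. 26) and
   non-isogeny gives inequivalence of the types (`IsCMTypeRealisation.exists_hom_ne_zero_iff_exists_ringEquiv`,
   [MilneCM] Prop. 3.13, with `isIsogeny_of_isSimple_of_ne_zero`).
2. Descent of each `(A'_c, ι'_c)` to a number field `k_c ⊂ ℚ̄` ([Shi98] §12.4 Prop. 26: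
   `shimura1998_prop26_definedOverQbar_holds`, `AbelianVariety.exists_numberField_descent_ringHom`), then base
   change to the compositum `k₀ = ⨆_c k_c` (the type is kept: `IsCMTypeRealisation.exists_iff_of_iso`,
   `IsCMTypeRealisationOver.baseChange`).
3. Descent of the isogeny exactly as in `CMStructureIsogenousPrimitivePower` ((N7a), [Shi98] §18.6 p. 127 (iv)):
   one finite `L′ ⊂ ℂ` over `k` and `k₀` rationalising all homomorphisms (`exists_intermediateField_surjective_homBaseChange_pair`),
   `IsIsogenous.of_surjective_homBaseChange`, then a finite hull `E ⊇ L′` normal over `ℚ`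
   (`exists_intermediateField_normal_rat_le`) and base change `L′ → E`.

## References

* [Shimura1998] G. Shimura, *Abelian Varieties with Complex Multiplication and Modular Functions* (1998): §5.1
  Prop. 3 (p. 36), §6.2 Thm. 3 (pp. 42–44), §8.2 Prop. 26 (p. 61), §12.4 Prop. 26, §18.6 p. 127 (iv), §18.7 p. 129.
* [Milne1999] J. S. Milne, *Lefschetz motives and the Tate conjecture*, Compositio Math. 117 (1999), §2 p. 54.
* [MilneCM2006] J. S. Milne, *Complex Multiplication* (2006), Ch. I §3 Prop. 3.13.
* [Faltings1983Endlichkeit] G. Faltings, Invent. Math. 73 (1983), §5 ¶1.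
-/

noncomputable section

open CategoryTheory CategoryTheory.Limits NumberField
open Literature.AlgebraicGeometry.Motives Literature.AlgebraicGeometry.Motives.AbelianVariety
open Literature.AlgebraicGeometry.ComplexMultiplication
open Literature.AlgebraicGeometry.Milne1999 (IsOfCMType)

universe u

namespace Literature.NumberTheory.ComplexMultiplication

/-! ## §1. Plumbing -/

section Plumbing

variable {K : Type u} [Field K]

/-- Isogeny classes are invariant under isomorphism of the two ends. [folklore] -/
private theorem isIsogenous_of_iso_of_iso' {X Y X' Y' : AbelianVariety K} (h : IsIsogenous X Y) (eX : X ≅ X')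
    (eY : Y ≅ Y') : IsIsogenous X' Y' := by
  obtain ⟨f, hf⟩ := h
  exact ⟨eX.inv ≫ f ≫ eY.hom, isIsogeny_comp (IsIsogeny.of_iso eX.symm) (isIsogeny_comp hf (IsIsogeny.of_iso eY))⟩

/-- An abelian variety of dimension `0` is a zero object. [folklore] -/
private theorem isZero_of_dim_eq_zero (X : AbelianVariety K) (hX : X.dim = 0) : IsZero X := by
  rw [IsZero.iff_id_eq_zero]
  exact hom_eq_zero_of_dim_eq_zero (Or.inl hX) (𝟙 X)

/-- The empty biproduct is a zero object. [folklore] -/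
private theorem isZero_biproduct_fin_zero (B : Fin 0 → AbelianVariety K) : IsZero (⨁ B) := by
  rw [IsZero.iff_id_eq_zero]
  exact biproduct.hom_ext _ _ fun j => Fin.elim0 j

/-- A CM structure over a number field `kc ⊂ ℚ̄` base-changes to any larger `k₀ ⊇ kc` inside `ℚ̄`, keeping its type
and its complexification. [cite: Shimura1998, §7.1 Prop. 7] -/
private theorem exists_model_over_of_le {K' : Type} [Field K'] [NumberField K'] (Φ : CMType K')
    {kc k₀ : IntermediateField ℚ (algebraicClosure ℚ ℂ)} [NumberField kc] (hle : kc ≤ k₀)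
    (B₂ : AbelianVariety kc) (ι₂ : 𝓞 K' →+* End B₂) (hB₂ : IsCMTypeRealisationOver Φ B₂ ι₂)
    (A' : AbelianVariety ℂ) (E₂ : B₂.baseChange ℂ ≅ A') :
    ∃ (B₃ : AbelianVariety k₀) (ι₃ : 𝓞 K' →+* End B₃),
      IsCMTypeRealisationOver Φ B₃ ι₃ ∧ Nonempty (B₃.baseChange ℂ ≅ A') := by
  letI alg : Algebra kc k₀ := (IntermediateField.inclusion hle).toRingHom.toAlgebra
  letI : SMul kc k₀ := alg.toSMul
  have h1 : ∀ x : kc, algebraMap kc ℂ x = algebraMap k₀ ℂ (algebraMap kc k₀ x) := fun _ => rfl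
  haveI : IsScalarTower kc k₀ ℂ := IsScalarTower.of_algebraMap_eq h1
  exact ⟨B₂.baseChange k₀, (B₂.endBaseChange k₀).comp ι₂, hB₂.baseChange,
    ⟨baseChangeTowerIso kc k₀ ℂ B₂ ≪≫ E₂⟩⟩

end Plumbing

/-! ## §2. Type-inequivalence of non-isogenous simple CM realisations -/

section Inequivalent

variable {K₀ K₁ : Type} [Field K₀] [NumberField K₀] [Field K₁] [NumberField K₁] {Φ₀ : CMType K₀} {Φ₁ : CMType K₁}
  {A₀ A₁ : AbelianVariety ℂ} {ι₀ : 𝓞 K₀ →+* End A₀} {θ₀ : K₀ →+* Module.End ℂ (AlgebraicGeometry.HodgeTheory.complexBetti A₀.X 1)}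
  {ι₁ : 𝓞 K₁ →+* End A₁} {θ₁ : K₁ →+* Module.End ℂ (AlgebraicGeometry.HodgeTheory.complexBetti A₁.X 1)}

/-- **Non-isogenous SIMPLE CM realisations have `Aut`-inequivalent types**: if `(A₀, ι₀, θ₀)`, `(A₁, ι₁, θ₁)` realise
`(K₀; Φ₀)`, `(K₁; Φ₁)` with `A₀`, `A₁` simple and NOT isogenous, then no field isomorphism `θ : K₀ ≃ K₁` carries
`Φ₀` to `Φ₁` — for such a `θ` Milne's Prop. 3.13 (`IsCMTypeRealisation.exists_hom_ne_zero_iff_exists_ringEquiv`)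
gives a non-zero `A₀ ⟶ A₁`, an isogeny between simple varieties (`isIsogeny_of_isSimple_of_ne_zero`).
[cite: MilneCM2006, Ch. I §3 Prop. 3.13 (p. 30)] [cite: MumfordAV1970, §19 Cor. 2 of Thm. 1 (p. 174)] -/
theorem inducedCMType_ne_of_not_isIsogenous_of_isSimple (h₀ : IsCMTypeRealisation Φ₀ A₀ ι₀ θ₀)
    (h₁ : IsCMTypeRealisation Φ₁ A₁ ι₁ θ₁) (hs₀ : A₀.IsSimple) (hs₁ : A₁.IsSimple) (hne : ¬ IsIsogenous A₀ A₁)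
    (θ : K₀ ≃+* K₁) : inducedCMType (θ : K₀ →+* K₁) Φ₀ ≠ Φ₁ := by
  intro hΦ
  have hex : ∃ e : K₀ ≃+* K₁, ∀ u : K₁ →+* ℂ, u ∈ Φ₁.1 ↔ u.comp e.toRingHom ∈ Φ₀.1 :=
    ⟨θ, fun u => by rw [← hΦ, mem_inducedCMType_iff]; rfl⟩
  obtain ⟨u, hu⟩ := (h₀.exists_hom_ne_zero_iff_exists_ringEquiv h₁ hs₀ hs₁).2 hex
  exact hne ⟨u, isIsogeny_of_isSimple_of_ne_zero hs₀ hs₁ u hu⟩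

end Inequivalent

/-! ## §3. The theorem -/

section Main

variable {k : Type} [Field k] [NumberField k] [Algebra k ℂ]

/-- **EVERY ABELIAN VARIETY OF CM TYPE (OVER `ℂ`) DEFINED OVER A NUMBER FIELD IS, OVER A FINITE NORMAL EXTENSION,
ISOGENOUS TO A BIPRODUCT OF PRIMITIVE CM STRUCTURES OF PAIRWISE INEQUIVALENT TYPES** ([Shi98] §5.1 Prop. 3 «`A` is
isogenous to a product `B × ⋯ × B`» and §18.7 «`A` is isogenous to `A_1 × ⋯ × A_t` … `(A_i, ι_i)` determines a
CM-type `(K_i, Φ_i)`», §8.2 Prop. 26, §12.4 Prop. 26 «defined over an algebraic number field of finite degree»,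
§18.6 p. 127 (iv); [Milne1999] §2; [Fal83] §5 ¶1).  For `A` over a number field `k ⊂ ℂ` with
`IsOfCMType (A ⊗ ℂ)`: a finite normal `E/k` inside `ℂ`, a finite family of structures `(B_c, ι_c)` of PRIMITIVE CM
types `(K_c, Φ_c)` over `E` (`K_c` CM fields) with `inducedCMType θ Φ_c ≠ Φ_{c'}` for all `c ≠ c'` and all field
isomorphisms `θ`, and `cls : Fin m → C` with `⨁_i B_{cls i} ∼ A ⊗_k E` and `A ⊗_k E ∼ ⨁_i B_{cls i}`.  The family block
is shaped for the tree's (N6c) head `faltings_tate_bijective_of_isIsogenous_biproduct_of_inducedCMType_ne` over `E`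
and `E` for `faltings_tate_bijective_of_baseChange_end (E := E)`.
[cite: Shimura1998, §5.1 Prop. 3 (p. 36); §8.2 Prop. 26 (p. 61); §12.4 Prop. 26; §18.6 p. 127 (iv); §18.7 p. 129]
[cite: Milne1999, §2 p. 54] [cite: Faltings1983Endlichkeit, §5 ¶1] -/
theorem exists_isIsogenous_biproduct_primitive_family_of_isOfCMType (A : AbelianVariety k)
    (hA : IsOfCMType (A.baseChange ℂ)) :
    ∃ (E : IntermediateField k ℂ), FiniteDimensional k E ∧ Normal k E ∧
      ∃ (C : Type) (_ : Fintype C) (K : C → Type) (_ : ∀ c, Field (K c)) (_ : ∀ c, NumberField (K c))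
        (_ : ∀ c, IsCMField (K c)) (Φ : ∀ c, CMType (K c)) (B : C → AbelianVariety E)
        (ιB : ∀ c, 𝓞 (K c) →+* End (B c)) (φ₀ : ∀ c, K c →+* ℂ),
        (∀ c, IsCMTypeRealisationOver (Φ c) (B c) (ιB c)) ∧
        (∀ c, IsPrimitive (ℂ ≃+* ℂ) (Φ c).1 (φ₀ c)) ∧
        (∀ c c', c ≠ c' → ∀ θ : K c ≃+* K c', inducedCMType (θ : K c →+* K c') (Φ c) ≠ Φ c') ∧
        ∃ (m : ℕ) (cls : Fin m → C),
          (⨁ fun i => B (cls i)).IsIsogenous (A.baseChange E) ∧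
            (A.baseChange E).IsIsogenous (⨁ fun i => B (cls i)) := by
  classical
  -- the degenerate case `dim A = 0`: empty family over `E = ⊥`
  rcases Nat.eq_zero_or_pos A.dim with hA0 | hApos
  · refine ⟨⊥, inferInstance, inferInstance, PEmpty, inferInstance, PEmpty.elim, (fun c => c.elim),
      (fun c => c.elim), (fun c => c.elim), (fun c => c.elim), (fun c => c.elim), (fun c => c.elim),
      (fun c => c.elim), (fun c => c.elim), (fun c => c.elim), (fun c c' => c.elim), 0, Fin.elim0, ?_⟩
    have hZ : IsZero (A.baseChange (⊥ : IntermediateField k ℂ)) :=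
      isZero_of_dim_eq_zero _ (by rw [dim_baseChange]; exact hA0)
    have hZ' : IsZero (⨁ fun i : Fin 0 => (PEmpty.elim (Fin.elim0 i : PEmpty) :
        AbelianVariety (⊥ : IntermediateField k ℂ))) := isZero_biproduct_fin_zero _
    exact ⟨⟨(hZ'.iso hZ).hom, IsIsogeny.of_iso (hZ'.iso hZ)⟩, ⟨(hZ.iso hZ').hom, IsIsogeny.of_iso (hZ.iso hZ')⟩⟩
  -- Step 1: decomposition over `ℂ` into simple, pairwise non-isogenous CM realisations
  have hX0 : 0 < (A.baseChange ℂ).dim := by rw [dim_baseChange]; exact hApos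
  obtain ⟨C, instC, K', instF, instNF, instCM, Φ', A', ι', θ', m, cls, f, hreal, hsimple, hnoniso, -, hf⟩ :=
    exists_isIsogeny_biproduct_of_isSimple_of_isOfCMType hX0 hA
  -- primitivity and type-inequivalence
  let φ₀ : ∀ c, K' c →+* ℂ := fun c => Classical.arbitrary _
  have hprim : ∀ c, IsPrimitive (ℂ ≃+* ℂ) (Φ' c).1 (φ₀ c) := fun c =>
    isPrimitive_of_isSimple (hreal c) (hsimple c) (φ₀ c)
  have hK : ∀ c c', c ≠ c' → ∀ θ : K' c ≃+* K' c', inducedCMType (θ : K' c →+* K' c') (Φ' c) ≠ Φ' c' :=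
    fun c c' hcc' θ => inducedCMType_ne_of_not_isIsogenous_of_isSimple (hreal c) (hreal c') (hsimple c)
      (hsimple c') (hnoniso c c' hcc') θ
  -- Step 2: number-field models of the factors, over one compositum `k₀ ⊂ ℚ̄`
  have hdesc : ∀ c, ∃ (kc : IntermediateField ℚ (algebraicClosure ℚ ℂ)) (_ : NumberField kc)
      (B₂ : AbelianVariety kc) (ι₂ : 𝓞 (K' c) →+* End B₂) (E₂ : B₂.baseChange ℂ ≅ A' c),
      ∀ a : 𝓞 (K' c), ((B₂.endBaseChange ℂ).comp ι₂) a ≫ E₂.hom = E₂.hom ≫ ι' c a := by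
    intro c
    obtain ⟨B₁, ι₁, e₁, he₁⟩ := shimura1998_prop26_definedOverQbar_holds (K' c) (Φ' c) (A' c) (ι' c) (θ' c) (hreal c)
    haveI : Algebra.IsAlgebraic ℚ (algebraicClosure ℚ ℂ) := algebraicClosure.isAlgebraic ℚ ℂ
    obtain ⟨kc, hkc, B₂, ι₂, e₂, he₂⟩ :=
      AbelianVariety.exists_numberField_descent_ringHom (algebraicClosure ℚ ℂ) B₁ ι₁
    haveI : NumberField kc := hkc
    refine ⟨kc, hkc, B₂, ι₂, (baseChangeTowerIso kc (algebraicClosure ℚ ℂ) ℂ B₂).symm ≪≫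
      (baseChangeFunctor (algebraicClosure ℚ ℂ) ℂ).mapIso e₂ ≪≫ e₁, fun a => ?_⟩
    change Hom.baseChange ℂ (ι₂ a : B₂ ⟶ B₂) ≫
      ((baseChangeTowerIso kc (algebraicClosure ℚ ℂ) ℂ B₂).inv ≫ Hom.baseChange ℂ e₂.hom ≫ e₁.hom) =
      ((baseChangeTowerIso kc (algebraicClosure ℚ ℂ) ℂ B₂).inv ≫ Hom.baseChange ℂ e₂.hom ≫ e₁.hom) ≫ ι' c a
    have h1 : Hom.baseChange ℂ (ι₂ a : B₂ ⟶ B₂) ≫ (baseChangeTowerIso kc (algebraicClosure ℚ ℂ) ℂ B₂).inv =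
        (baseChangeTowerIso kc (algebraicClosure ℚ ℂ) ℂ B₂).inv ≫
          Hom.baseChange ℂ (Hom.baseChange (algebraicClosure ℚ ℂ) (ι₂ a : B₂ ⟶ B₂)) :=
      (baseChangeTowerIso_inv_comp_baseChange_baseChange (↥(algebraicClosure ℚ ℂ)) ℂ (ι₂ a : B₂ ⟶ B₂)).symm
    have h2 : Hom.baseChange ℂ (Hom.baseChange (algebraicClosure ℚ ℂ) (ι₂ a : B₂ ⟶ B₂)) ≫
        Hom.baseChange ℂ e₂.hom = Hom.baseChange ℂ e₂.hom ≫ Hom.baseChange ℂ (ι₁ a : B₁ ⟶ B₁) := by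
      rw [← Hom.baseChange_comp, he₂, Hom.baseChange_comp]
    rw [← Category.assoc, h1, Category.assoc, ← Category.assoc (Hom.baseChange ℂ (Hom.baseChange _ _)), h2,
      Category.assoc, he₁]
    simp only [Category.assoc]
  choose kk hkk B₂ ι₂ E₂ hE₂ using hdesc
  have hB₂ : ∀ c, IsCMTypeRealisationOver (Φ' c) (B₂ c) (ι₂ c) := fun c =>
    (IsCMTypeRealisation.exists_iff_of_iso (E₂ c) (hE₂ c)).2 ⟨θ' c, hreal c⟩
  -- the compositum `k₀` and the models over it
  let k₀ : IntermediateField ℚ (algebraicClosure ℚ ℂ) := ⨆ c, kk c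
  haveI hfd : ∀ c, FiniteDimensional ℚ (kk c) := fun c => (hkk c).to_finiteDimensional
  haveI : FiniteDimensional ℚ k₀ := IntermediateField.finiteDimensional_iSup_of_finite
  haveI : NumberField k₀ := NumberField.mk
  have hmodel : ∀ c, ∃ (B₃ : AbelianVariety k₀) (ι₃ : 𝓞 (K' c) →+* End B₃),
      IsCMTypeRealisationOver (Φ' c) B₃ ι₃ ∧ Nonempty (B₃.baseChange ℂ ≅ A' c) := fun c => by
    haveI := hkk c
    exact exists_model_over_of_le (Φ' c) (le_iSup kk c) (B₂ c) (ι₂ c) (hB₂ c) (A' c) (E₂ c)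
  choose B₃ ι₃ hB₃ hE₃ using hmodel
  let E₃ : ∀ c, (B₃ c).baseChange ℂ ≅ A' c := fun c => (hE₃ c).some
  -- Step 3: `A ⊗ ℂ ∼ (⨁_i B₃ (cls i)) ⊗ ℂ`
  set B₀ : AbelianVariety k₀ := ⨁ fun i => B₃ (cls i) with hB₀
  obtain ⟨eB₀⟩ := nonempty_baseChange_biproduct_iso ℂ (fun i => B₃ (cls i))
  have hisoC : (A.baseChange ℂ).IsIsogenous (B₀.baseChange ℂ) := by
    refine isIsogenous_of_iso_of_iso' ⟨f, hf⟩ (Iso.refl _) ?_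
    exact biproduct.mapIso (fun i => (E₃ (cls i)).symm) ≪≫ eB₀.symm
  -- Step 4: a common finite field of rationality `L′ ⊂ ℂ` over `k` and `k₀`; descend the isogeny
  obtain ⟨L', hL'fd, instAlg, instTower, hsurj₁, hsurj₂⟩ :=
    exists_intermediateField_surjective_homBaseChange_pair A B₀
  haveI := hL'fd
  letI := instAlg
  haveI := instTower
  have hisoL'C : ((A.baseChange L').baseChange ℂ).IsIsogenous ((B₀.baseChange L').baseChange ℂ) :=
    isIsogenous_of_iso_of_iso' hisoC (baseChangeTowerIso k L' ℂ A).symm (baseChangeTowerIso k₀ L' ℂ B₀).symm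
  obtain ⟨hisoL', hisoL'symm⟩ := IsIsogenous.of_surjective_homBaseChange ℂ hsurj₁ hsurj₂ hisoL'C
  -- Step 5: a finite hull `E ⊇ L′` normal over `ℚ`, hence over `k`; base change `L′ → E`
  obtain ⟨E, hEfd, hEnormal, hleE, -⟩ :=
    exists_intermediateField_normal_rat_le L' (⊥ : IntermediateField ℚ ℂ)
  haveI := hEfd
  haveI := hEnormal
  haveI : Normal k E := Normal.tower_top_of_normal ℚ k E
  letI : Algebra L' E := (IntermediateField.inclusion hleE).toRingHom.toAlgebra
  haveI : IsScalarTower k L' E := IsScalarTower.of_algebraMap_eq fun _ => rfl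
  haveI : IsScalarTower L' E ℂ := IsScalarTower.of_algebraMap_eq fun _ => rfl
  letI : Algebra k₀ E := ((algebraMap L' E).comp (algebraMap k₀ L')).toAlgebra
  haveI : IsScalarTower k₀ L' E := IsScalarTower.of_algebraMap_eq fun _ => rfl
  haveI : IsScalarTower k₀ E ℂ := IsScalarTower.of_algebraMap_eq fun x => by
    change algebraMap k₀ ℂ x = algebraMap L' ℂ (algebraMap k₀ L' x)
    exact IsScalarTower.algebraMap_apply k₀ L' ℂ x
  obtain ⟨eBE⟩ := nonempty_baseChange_biproduct_iso E (fun i => B₃ (cls i))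
  have hAE : (A.baseChange E).IsIsogenous (⨁ fun i => (B₃ (cls i)).baseChange E) :=
    isIsogenous_of_iso_of_iso' (hisoL'.baseChange E) (baseChangeTowerIso k L' E A)
      (baseChangeTowerIso k₀ L' E B₀ ≪≫ eBE)
  have hEA : (⨁ fun i => (B₃ (cls i)).baseChange E).IsIsogenous (A.baseChange E) :=
    isIsogenous_of_iso_of_iso' (hisoL'symm.baseChange E) (baseChangeTowerIso k₀ L' E B₀ ≪≫ eBE)
      (baseChangeTowerIso k L' E A)
  exact ⟨E, hEfd, inferInstance, C, instC, K', instF, instNF, instCM, Φ', fun c => (B₃ c).baseChange E,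
    fun c => ((B₃ c).endBaseChange E).comp (ι₃ c), φ₀, fun c => (hB₃ c).baseChange, hprim, hK, m + 1, cls,
    hEA, hAE⟩

end Main

end Literature.NumberTheory.ComplexMultiplication

end
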